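import Summits.Ventures.CertifiedManyBodySolver.Observables.StiffnessTLOddMomentIdentificationTT
import Summits.Ventures.CertifiedManyBodySolver.Observables.StiffnessTLOddMomentOrbitRow
import Literature.MathematicalPhysics.QuantumLattice.HubbardNNNHoppingWindowCertificateD4
import HarnessLib

/-!
# Ventures/CertifiedManyBodySolver — Observables: the odd-moment (Krylov-3) stiffness row for the `t–t'`
# torus as a `D₄`-ORBIT-MEAN window row (any real `t'`; the A0 anchor `(8, 7/8, −1/4)`)

HONEST FRAMING: one-sided CEILINGS on the flux stiffness (helicity modulus / superfluid weight); not
a superconductivity verdict; no stiffness floor follows from equal-time data and an energy window.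

Cell `hubbard-obs` (D-0042), seat p2 (stiffness). `t'`-general twin of `StiffnessTLOddMomentOrbitRow.lean`:

* `oddMomentObsTT t' U λ = X_λ = ½ k₀ + λ d₁ − (λ²/2) m₃' ∈ 𝔄_{[-7,7]²}` (the `t–t'` bond / commutator observables
  of `StiffnessTLOddMomentLocalObsTT.lean`), `Re ω(X_λ) = oddMomentLimitFunctionalTT t' U λ ω`;
* `rotOddMomentFunctionalTT'_eq_torusAvgExpect` — the per-side functional in the rotated ground state `U_{γ⁻¹}ψ`
  (`D_γ H^{tt'} D_γᴴ = H^{tt'}`, `relabel_d4Perm_hubbardTorusTT'`) is the translation average of the ROTATED window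
  observable `Γ(d4Emb γ 0 Λ₇) X_λ` (`D₄` covariance, `torusAvgExpect_d4Emb_eq`);
* `fluxStiffness_le_of_torusLimitTT'_oddMoment_orbit_certificate` — for a nonempty `S ⊆ D₄`, a certificate
  `|S|⁻¹ Σ_{γ∈S} Re ω_{γΛ₇}(Γ(d4Emb γ 0 Λ₇) X_λ) ≤ q` on the `t–t'` torus-limit ground-state class gives `ρ_s ≤ q`;
* `fluxStiffness_le_of_oddMomentTT_orbitLowerRow_neg` — the registry shape
  `SquareTTPrimeCorrOrbitLowerRow t' U (1−δ) u r S (box 2 7) (−X_λ)` + energy cap `e(U, 1−δ, t') ≤ u` ⇒ `ρ_s ≤ −r`;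
  `m3_tpm1o4_fluxStiffness_le_of_oddMoment_orbitLowerRow_neg` is the A0 instance
  (`M3CorrOrbitLowerRow (−1/4) u r S (box 2 7) (−oddMomentObsTT (−1/4) 8 λ)`, flux envelope `fluxEnergyTT' L (−1/4) 8 (1/8)`).
  With `λ = 0` these are the f-sum (kinetic) ceilings at `t' ≠ 0`, which had no torus-limit adapter before.

References: [Kohn1964]; [ScalapinoWhiteZhang1993] §II; [Lipparini2008] eq. (8.30); [Scalapino1995] §2;
[XuEtAl2024] eq. (1); [BratteliRobinsonII1997] §5.2.2, Thm. 5.2.5; [BratteliRobinsonI1987] §4.3.1.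
-/

noncomputable section

namespace Summit.Ventures.CertifiedManyBodySolver.Observables

open Matrix Finset Filter Topology
open Literature.MathematicalPhysics.QuantumLattice
open Literature.MathematicalPhysics.QuantumLattice.ThermodynamicLimit
open Literature.MathematicalPhysics.QuantumFieldTheory
open Literature.Probability.LatticeModels
open scoped ComplexOrder ComplexConjugate Topology

/-! ### The single window observable `X_λ` of the `t–t'` row -/

/-- `X_λ = ½ k₀ + λ d₁ − (λ²/2) m₃' ∈ 𝔄_{[-7,7]²}` for the `t–t'` torus. [cite: Lipparini2008, eq. (8.30)] -/
def oddMomentObsTT (tp U lam : ℝ) : FermionOp (box 2 7) :=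
  (((1 / 2 : ℝ) : ℂ) • fermionEmbed (PolySite.incl (box_subset_box (by norm_num))) (kinBondObsTT tp) +
      ((lam : ℝ) : ℂ) • fermionEmbed (PolySite.incl (box_subset_box (by norm_num))) (firstMomentObsTT tp U)) -
    ((lam ^ 2 / 2 : ℝ) : ℂ) • thirdMomentObsTT tp U

/-- `Re ω(X_λ) = ½Re ω(k₀) + λ Re ω(d₁) − (λ²/2) Re ω(m₃')`. [cite: Lipparini2008, eq. (8.30)] -/
theorem re_expect_oddMomentObsTT (tp U lam : ℝ) (ω : InfVolFermionState 2) :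
    (ω.expect (box 2 7) (oddMomentObsTT tp U lam)).re = oddMomentLimitFunctionalTT tp U lam ω := by
  unfold oddMomentObsTT oddMomentLimitFunctionalTT
  rw [map_sub, map_add, map_smul, map_smul, map_smul, ω.compatible, ω.compatible, smul_eq_mul, smul_eq_mul,
    smul_eq_mul, Complex.sub_re, Complex.add_re, Complex.re_ofReal_mul, Complex.re_ofReal_mul,
    Complex.re_ofReal_mul]
  ring

section Finite

variable (L : ℕ) [NeZero L]

/-- The translation average of `X_λ` is the combination of the three averages (`t–t'`). [cite: Lipparini2008, eq. (8.30)] -/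
theorem torusAvgExpectAt_oddMomentObsTT (tp U lam : ℝ) (h7 : Set.InjOn (Torus.proj (d := 2) L) ↑(box 2 7))
    (ψ : Fock (Orb (FermionTorus 2 L))) :
    torusAvgExpectAt L (box 2 7) (oddMomentObsTT tp U lam) ψ =
      ((1 / 2 : ℝ) : ℂ) * torusAvgExpectAt L (box 2 1) (kinBondObsTT tp) ψ +
        ((lam : ℝ) : ℂ) * torusAvgExpectAt L (box 2 4) (firstMomentObsTT tp U) ψ -
        ((lam ^ 2 / 2 : ℝ) : ℂ) * torusAvgExpectAt L (box 2 7) (thirdMomentObsTT tp U) ψ := by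
  unfold oddMomentObsTT
  rw [torusAvgExpectAt_sub' L h7, torusAvgExpectAt_add' L h7, torusAvgExpectAt_smul' L h7,
    torusAvgExpectAt_smul' L h7, torusAvgExpectAt_smul' L h7, torusAvgExpectAt_incl L _ h7,
    torusAvgExpectAt_incl L _ h7]

/-- `U_{γ⁻¹}` maps sector ground states of the `t–t'` torus to sector ground states
(`D_γ H^{tt'} D_γᴴ = H^{tt'}`). [cite: XuEtAl2024, eq. (1)] -/
theorem isGroundStateInSector_fockD4_inv_mulVec_TT (tp U : ℝ) (γ : DihedralGroup 4) {N : ℕ} {M : ℝ}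
    {ψ : Fock (Orb (FermionTorus 2 L))} (hgs : IsGroundStateInSector (hubbardTorusTT' L 1 tp U) N M ψ) :
    IsGroundStateInSector (hubbardTorusTT' L 1 tp U) N M ((fockD4 (L := L) γ⁻¹).val *ᵥ ψ) :=
  hgs.fockD4_mulVec γ⁻¹ (relabel_d4Perm_hubbardTorusTT' γ⁻¹ 1 tp U)

end Finite

/-! ### The rotated per-side functional and its identification -/

/-- The per-side `t–t'` odd-moment functional evaluated in the rotated vector `U_{γ⁻¹} ψ`
(junk value `0` at `L = 0`). [cite: Lipparini2008, eq. (8.30)] -/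
def rotOddMomentFunctionalTT' (tp U δ lam : ℝ) (γ : DihedralGroup 4) (L : ℕ)
    (ψ : Fock (Orb (FermionTorus 2 L))) : ℝ :=
  if hL : L = 0 then 0 else
    haveI : NeZero L := ⟨hL⟩
    oddMomentFunctionalTT' tp U δ lam L ((fockD4 (L := L) γ⁻¹).val *ᵥ ψ)

/-- At a side `L ≠ 0`. [cite: Lipparini2008, eq. (8.30)] -/
theorem rotOddMomentFunctionalTT'_eq (tp U δ lam : ℝ) (γ : DihedralGroup 4) (L : ℕ) [NeZero L]
    (ψ : Fock (Orb (FermionTorus 2 L))) :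
    rotOddMomentFunctionalTT' tp U δ lam γ L ψ =
      oddMomentFunctionalTT' tp U δ lam L ((fockD4 (L := L) γ⁻¹).val *ᵥ ψ) := by
  rw [rotOddMomentFunctionalTT', dif_neg (NeZero.ne L)]

/-- The limit functional of the rotated copy: `Re ω_{γΛ₇}(Γ(d4Emb γ 0 Λ₇) X_λ)`. [cite: Lipparini2008, eq. (8.30)] -/
def rotOddMomentLimitFunctionalTT (tp U lam : ℝ) (γ : DihedralGroup 4) (ω : InfVolFermionState 2) : ℝ :=
  (ω.expect (d4ShiftSet γ 0 (box 2 7)) (fermionEmbed (PolySite.d4Emb γ 0 (box 2 7)) (oddMomentObsTT tp U lam))).re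

section Finite

variable (L : ℕ) [NeZero L]

/-- **The rotated functional is the translation average of the ROTATED window observable** (`t–t'` torus,
`L ≥ 15`, sector ground states). [cite: BratteliRobinsonII1997, §5.2.2, Thm. 5.2.5] -/
theorem rotOddMomentFunctionalTT'_eq_torusAvgExpect (tp U δ lam : ℝ) (γ : DihedralGroup 4) (hL : 15 ≤ L)
    {ψ : Fock (Orb (FermionTorus 2 L))}
    (hgs : IsGroundStateInSector (hubbardTorusTT' L 1 tp U) (2 * ⌊(1 - δ) * (L : ℝ) ^ 2 / 2⌋₊) 0 ψ) :
    rotOddMomentFunctionalTT' tp U δ lam γ L ψ =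
      (torusAvgExpect L (d4ShiftSet γ 0 (box 2 7))
        (fermionEmbed (PolySite.d4Emb γ 0 (box 2 7)) (oddMomentObsTT tp U lam)) ψ).re := by
  have h7 : Set.InjOn (Torus.proj (d := 2) L) ↑(box 2 7) := injOn_proj_box (by omega)
  rw [rotOddMomentFunctionalTT'_eq, oddMomentFunctionalTT'_eq_torusAvgExpect L tp U δ lam hL
      (isGroundStateInSector_fockD4_inv_mulVec_TT L tp U γ hgs),
    torusAvgExpect_d4Emb_eq L γ h7, torusAvgExpect_eq, torusAvgExpect_eq, torusAvgExpect_eq, torusAvgExpect_eq,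
    torusAvgExpectAt_oddMomentObsTT L tp U lam h7, Complex.sub_re, Complex.add_re, Complex.re_ofReal_mul,
    Complex.re_ofReal_mul, Complex.re_ofReal_mul]
  ring

/-- **The odd-moment ceiling in every rotated copy** (`t–t'` torus, `L ≥ 3`). [cite: Kohn1964] -/
theorem fluxStiffness_le_rotOddMomentFunctionalTT' (hL : 3 ≤ L) (tp : ℝ) {U δ ρs θ₀ : ℝ} (hθ₀ : 0 < θ₀)
    (hst : ∀ θ : ℝ, |θ| ≤ θ₀ → ρs * θ ^ 2 ≤ fluxEnergyTT' L tp U δ θ - fluxEnergyTT' L tp U δ 0)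
    {ψ : Fock (Orb (FermionTorus 2 L))}
    (hgs : IsGroundStateInSector (hubbardTorusTT' L 1 tp U) (2 * ⌊(1 - δ) * (L : ℝ) ^ 2 / 2⌋₊) 0 ψ)
    (h1 : star ψ ⬝ᵥ ψ = 1) (lam : ℝ) (γ : DihedralGroup 4) :
    ρs ≤ rotOddMomentFunctionalTT' tp U δ lam γ L ψ := by
  have hfin := fluxStiffness_mul_sq_le_kinetic_add_oddMomentsTT L hL tp hθ₀ hst
    (isGroundStateInSector_fockD4_inv_mulVec_TT L tp U γ hgs) (by rw [star_fockD4_inv_mulVec_dotProduct, h1]) lam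
  have hLpos : (0 : ℝ) < (L : ℝ) ^ 2 := by
    have : (0 : ℝ) < (L : ℝ) := Nat.cast_pos.2 (NeZero.pos L)
    positivity
  rw [rotOddMomentFunctionalTT'_eq, oddMomentFunctionalTT'_eq, le_div_iff₀ hLpos]
  exact hfin

end Finite

/-! ### The orbit-mean adapter and the registry shape -/

/-- **The `t–t'` odd-moment row as a `D₄`-orbit-mean row.** Let `−1 ≤ δ ≤ 1`, `λ ∈ ℝ`, `S ⊆ D₄` nonempty, and
let `ρ_s, θ₀ > 0` be a uniform flux stiffness of the zero-flux sectors of `hubbardTorusTT' L 1 t' U` along all even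
`L ≥ L₀`. If `|S|⁻¹ Σ_{γ∈S} Re ω_{γΛ₇}(Γ(d4Emb γ 0 Λ₇) X_λ) ≤ q` for EVERY torus limit `ω` of unit sector ground
states along sides `Ls → ∞`, then `ρ_s ≤ q`. [cite: ScalapinoWhiteZhang1993, §II] -/
theorem fluxStiffness_le_of_torusLimitTT'_oddMoment_orbit_certificate (tp : ℝ) {U δ ρs θ₀ q : ℝ} (lam : ℝ)
    (S : Finset (DihedralGroup 4)) (hS : S.Nonempty) (hδ : -1 ≤ δ) (hδ1 : δ ≤ 1) (hθ₀ : 0 < θ₀) {L₀ : ℕ}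
    (hst : ∀ (L : ℕ) [NeZero L], L₀ ≤ L → Even L →
      ∀ θ : ℝ, |θ| ≤ θ₀ → ρs * θ ^ 2 ≤ fluxEnergyTT' L tp U δ θ - fluxEnergyTT' L tp U δ 0)
    (hrow : ∀ (ω : InfVolFermionState 2) (Ls : ℕ → ℕ) (ψ : ∀ L, Fock (Orb (FermionTorus 2 L))),
      Tendsto Ls atTop atTop →
      (∀ j, IsGroundStateInSector (hubbardTorusTT' (Ls j) 1 tp U) (rectN (1 - δ) (Ls j)) 0 (ψ (Ls j))) →
      (∀ j, star (ψ (Ls j)) ⬝ᵥ ψ (Ls j) = 1) → ω.IsTorusLimitOf ψ Ls →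
        (S.card : ℝ)⁻¹ * ∑ γ ∈ S, rotOddMomentLimitFunctionalTT tp U lam γ ω ≤ q) :
    ρs ≤ q := by
  have hcard : (0 : ℝ) < (S.card : ℝ) := Nat.cast_pos.2 (Finset.card_pos.2 hS)
  refine fluxStiffness_le_of_torusLimitTT'_functional_row tp hδ hδ1 (L₀ := L₀)
    (fun L ψ => (S.card : ℝ)⁻¹ * ∑ γ ∈ S, rotOddMomentFunctionalTT' tp U δ lam γ L ψ)
    (fun ω => (S.card : ℝ)⁻¹ * ∑ γ ∈ S, rotOddMomentLimitFunctionalTT tp U lam γ ω) ?_ ?_ hrow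
  · intro L _ hL0 hL3 hEven ψ hgs h1
    have hsum : ∑ _γ ∈ S, ρs ≤ ∑ γ ∈ S, rotOddMomentFunctionalTT' tp U δ lam γ L ψ :=
      Finset.sum_le_sum fun γ _ =>
        fluxStiffness_le_rotOddMomentFunctionalTT' L hL3 tp hθ₀ (hst L hL0 hEven) hgs h1 lam γ
    rw [Finset.sum_const, nsmul_eq_mul] at hsum
    rw [inv_mul_eq_div, le_div_iff₀ hcard]
    linarith
  · intro ω Ls ψ hLs hgs h1 hω
    refine Tendsto.const_mul _ (tendsto_finsetSum _ fun γ _ => ?_)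
    have hlim : Tendsto (fun j => (torusAvgExpect (Ls j) (d4ShiftSet γ 0 (box 2 7))
        (fermionEmbed (PolySite.d4Emb γ 0 (box 2 7)) (oddMomentObsTT tp U lam)) (ψ (Ls j))).re) atTop
        (𝓝 (rotOddMomentLimitFunctionalTT tp U lam γ ω)) :=
      (Complex.continuous_re.tendsto _).comp (hω _ _)
    refine hlim.congr' ?_
    filter_upwards [hLs.eventually_ge_atTop 15] with j hj
    haveI : NeZero (Ls j) := ⟨by omega⟩
    exact (rotOddMomentFunctionalTT'_eq_torusAvgExpect (Ls j) tp U δ lam γ hj (hgs j)).symm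

/-- **Registry shape: a LOWER orbit row on the NEGATED word is a stiffness CEILING** (`t–t'` torus): the cell
`SquareTTPrimeCorrOrbitLowerRow t' U (1−δ) u r S Λ₇ (−X_λ)` (`S` nonempty) with the certified energy cap
`e(U, 1−δ, t') ≤ u` gives `ρ_s ≤ −r` for every uniform flux stiffness. [cite: ScalapinoWhiteZhang1993, §II] -/
theorem fluxStiffness_le_of_oddMomentTT_orbitLowerRow_neg (tp : ℝ) {U δ ρs θ₀ : ℝ} (lam : ℝ) {u r : ℚ}
    (S : Finset (DihedralGroup 4)) (hS : S.Nonempty) (hδ : -1 ≤ δ) (hδ1 : δ ≤ 1) (hθ₀ : 0 < θ₀) {L₀ : ℕ}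
    (hst : ∀ (L : ℕ) [NeZero L], L₀ ≤ L → Even L →
      ∀ θ : ℝ, |θ| ≤ θ₀ → ρs * θ ^ 2 ≤ fluxEnergyTT' L tp U δ θ - fluxEnergyTT' L tp U δ 0)
    (hrow : SquareTTPrimeCorrOrbitLowerRow tp U (1 - δ) u r S (box 2 7) (-oddMomentObsTT tp U lam))
    (hu : energyDensityTT' 1 tp U (1 - δ) ≤ ((u : ℚ) : ℝ)) :
    ρs ≤ -((r : ℚ) : ℝ) := by
  refine fluxStiffness_le_of_torusLimitTT'_oddMoment_orbit_certificate tp lam S hS hδ hδ1 hθ₀ hst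
    fun ω Ls ψ hLs hgs h1 hω => ?_
  have h := hrow ω Ls ψ hLs hgs h1 hω hu
  have hneg : ∀ γ : DihedralGroup 4,
      (ω.expect (d4ShiftSet γ 0 (box 2 7))
        (fermionEmbed (PolySite.d4Emb γ 0 (box 2 7)) (-oddMomentObsTT tp U lam))).re =
        -rotOddMomentLimitFunctionalTT tp U lam γ ω := fun γ => by
    rw [rotOddMomentLimitFunctionalTT, map_neg, map_neg, Complex.neg_re]
  simp only [hneg, Finset.sum_neg_distrib, mul_neg] at h
  linarith

/-- **A0 instance (`U = 8`, `n = 7/8`, `t' = −1/4`): the Lean cell for a certified odd-moment (or, at `λ = 0`,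
kinetic) stiffness edge at the cell's A0 anchor.** If `M3CorrOrbitLowerRow (−1/4) u r S (box 2 7) (−oddMomentObsTT (−1/4) 8 λ)`
holds (`S` nonempty) and the energy cap `e₀(8, 7/8, −1/4) ≤ u` is certified (node #445 type), then every uniform
flux stiffness `ρ_s` (scale `θ₀ > 0`, all even `L ≥ L₀`) of the zero-flux `(N_L, 0)` sectors of
`hubbardTorusTT' L 1 (−1/4) 8` at density `7/8` satisfies `ρ_s ≤ −r` (tree units). HONEST FRAMING: one-sided ceiling;
not a superconductivity verdict. [cite: ScalapinoWhiteZhang1993, §II] -/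
theorem m3_tpm1o4_fluxStiffness_le_of_oddMoment_orbitLowerRow_neg (lam : ℝ) {u r : ℚ}
    (S : Finset (DihedralGroup 4)) (hS : S.Nonempty)
    (hrow : M3CorrOrbitLowerRow (-1 / 4) u r S (box 2 7) (-oddMomentObsTT (-1 / 4) 8 lam))
    (hu : energyDensityTT' 1 (-1 / 4) 8 (7 / 8) ≤ ((u : ℚ) : ℝ)) :
    ∀ (ρs θ₀ : ℝ), 0 < θ₀ → ∀ L₀ : ℕ,
      (∀ (L : ℕ) [NeZero L], L₀ ≤ L → Even L →
        ∀ θ : ℝ, |θ| ≤ θ₀ →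
          ρs * θ ^ 2 ≤ fluxEnergyTT' L (-1 / 4) 8 (1 / 8) θ - fluxEnergyTT' L (-1 / 4) 8 (1 / 8) 0) →
      ρs ≤ -((r : ℚ) : ℝ) := by
  intro ρs θ₀ hθ₀ L₀ hst
  have hrow' : SquareTTPrimeCorrOrbitLowerRow (-1 / 4) 8 (1 - 1 / 8) u r S (box 2 7)
      (-oddMomentObsTT (-1 / 4) 8 lam) := by
    rw [show (1 - 1 / 8 : ℝ) = 7 / 8 by norm_num]; exact hrow
  have hu' : energyDensityTT' 1 (-1 / 4) 8 (1 - 1 / 8) ≤ ((u : ℚ) : ℝ) := by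
    rw [show (1 - 1 / 8 : ℝ) = 7 / 8 by norm_num]; exact hu
  exact fluxStiffness_le_of_oddMomentTT_orbitLowerRow_neg (-1 / 4) lam S hS (by norm_num) (by norm_num) hθ₀ hst
    hrow' hu'

end Summit.Ventures.CertifiedManyBodySolver.Observables

end
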